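import Literature.MathematicalPhysics.QuantumFieldTheory.BalabanImbrieJaffe1984to88.BIJ88Ineq217Mechanism
import Literature.MathematicalPhysics.QuantumFieldTheory.BalabanImbrieJaffe1984to88.BIJ88Ineq217NearPart

/-!
# `BalabanImbrieJaffe1984to88.BIJ88Ineq217Torus` — T. Bałaban, J. Imbrie, A. Jaffe, *Effective action and cluster properties of the
abelian Higgs model*, Commun. Math. Phys. **114** (1988) 257–315 [BalabanImbrieJaffe1988]: **(2.17)** p. 262 ON THE TORUS CARRIERS OF RECORD —
the printed argument (`BIJ88Ineq217Mechanism`, p253429) fed with the near part constructed in `BIJ88Ineq217NearPart` (p253816): for a kernel `σ`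
on the plaquettes `Plaq P j` of `Setup` with the threshold decay (2.16) and bounded on curls, and `f = ∂A` on a box around `p₁`,
`|(σf)(p₁)| ≤ C‖f‖_∞` with `C` explicit; the plaquette row sums of the torus discharged (p20's `B3TorusRadialSums`)

statement-level skeleton of published theorems with citation tags; proofs where landed; nothing here is a claim about the Yang–Mills mass gap

PDF held: `paper:balaban1988-cmp114-bij-abelian-higgs-effective-action` (journal page = PDF page + 256); p. 262 [PDF 6] read as an image
(seat folder `renders/bij88-p006.png`) and from the text layer.

WHAT IS REPRODUCED.  SKELETON row **C2.Eq2.17**, file 3 of the seat's (2.17) set (cell `lit-balaban`, HOME `run/shared/lean/pub/lit-balaban/`;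
Phase-2 seat p08 gen 6 = unit `lit-balaban-p08`; C2 §§1–4 fold owner r18, referee ref-5; TAKING line HOME/STATUS.md 2026-08-21T06:46:30Z).
p. 262 [PDF 6], verbatim: *"we shall only encounter situations where f^{(k)}(p₂) = (∂A)(p₂) for p₂ near p₁. Then we prove that
(σ_kf^{(k)})(p₁) ≦ ‖f^{(k)}‖_∞ (2.17) as follows. Write f^{(k)} = ∂□A + f′, where □ is the characteristic function of a neighborhood of p₂. The
distant part (σ_kf′)(p₁) is easily estimated by ‖f^{(k)}‖_∞ by (2.16). The near part is similarly bounded since σ_k is a bounded operator on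
curls [2]."*

WHAT IS PROVED HERE (0 `sorry`, standard axioms; theorems only — proof lane —, kind «model instance» of the hence-step).  On `α = Plaq P j` with the distance
`pdist p q = tdist(p.src, q.src)` (torus `ℓ¹` distance of the base points):
§1 `castSite_lift` (every torus site is the projection of its canonical `ℤ^d` lift), `sum_plaq_le_sum_site`, **`sum_plaq_exp_neg_pdist_le`**
(`Σ_{p₂} e^{−a·pdist(p₁,p₂)} ≤ d²(2(1+a⁻¹))^d`, uniformly in the torus: p20's `sum_exp_neg_tdist_le`).
§2 **`abs_ineq217_torus`**: (2.16) at `p₁` beyond `R` with rate `δ`, row sum `≤ S`, `|(σg)(p₁)| ≤ M‖g‖_∞` on curls `g = ∂^{c}B`, and THE PRINTED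
HYPOTHESIS `f(p₂) = (∂^{c}A)(p₂)` on the box of radius `R` about the base point of `p₁` (`2R < sitesPerDir j`, `c ≠ 0`) ⟹
`|(σf)(p₁)| ≤ (M·8(d−1)R + c₀S(1 + 8(d−1)R))·‖f‖_∞`; **`abs_ineq217_torus'`** with the row sum discharged (`δ > 0`, `S = d²(2(1+δ⁻¹))^d`).
§3 **`ineq217_typed_torus`**: r18's `BIJ88Sect2Statements.Ineq217 σ Near` (print's display, constant 1) with `Near p₁ f` := THE PRINTED SIDE
CONDITION «f = ∂A for p₂ near p₁» (`∃ A, f = ∂^{c}A` on the box of radius `R` about the canonical lift of `p₁.src`), inhabited whenever the explicit constant is `≤ 1`.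
HONEST SCOPE.  (2.16) for the concrete σ_k and its boundedness on curls ([2]) remain displayed hypotheses (rows C2.Eq2.16, C1 §7.1); the constant
is explicit, not optimised, and print's constant-free `≦` is the paper's generic-constant convention; non-wrapping box only.  NOT summit progress.
-/

namespace Literature.MathematicalPhysics.QuantumFieldTheory.BalabanImbrieJaffe1984to88.BIJ88Ineq217Torus

open Balaban1983to89 hiding Site Plaq
open Balaban1983to89.LatticeFieldCalculus Balaban1983to89.T4AxialGaugeSmallField Balaban1983to89.B3TorusRadialSums
open BIJ88Sect2Statements BIJ88Close235Proof BIJ88Ineq217Mechanism BIJ88Ineq217NearPart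
-- fresh names for the torus carriers of `Setup` (the bare `Site`/`Plaq` are shadowed inside this namespace, cf. `BIJ88Ineq217NearPart`)
open Balaban1983to89 renaming Site → TSite, Plaq → TPlaq

noncomputable section

variable {P : Params} {j : ℕ}

/-! ## §1  Lifts and plaquette row sums on the torus -/

/-- Every torus site is the projection of its canonical `ℤ^d` lift (least nonnegative representatives).
[cite: BalabanImbrieJaffe1988, (2.17) p.262] -/
theorem castSite_lift (x : TSite P j) : (castSite (fun κ => ((x κ).val : ℤ)) : TSite P j) = x := by
  funext κ
  rw [castSite_apply, Int.cast_natCast, ZMod.natCast_zmod_val]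

/-- A nonnegative site function summed over plaquettes (through the base point) is at most `d²` times its site sum.
[cite: BalabanImbrieJaffe1988, (2.16) p.261] -/
theorem sum_plaq_le_sum_site {F : TSite P j → ℝ} (hF : ∀ x, 0 ≤ F x) :
    ∑ p : TPlaq P j, F p.src ≤ (P.d : ℝ) * P.d * ∑ x : TSite P j, F x := by
  classical
  let ι : TPlaq P j → TSite P j × Fin P.d × Fin P.d := fun p => (p.src, p.μ, p.ν)
  have hι : Function.Injective ι := by
    rintro ⟨s, μ, ν, h⟩ ⟨s', μ', ν', h'⟩ hh
    simp only [ι, Prod.mk.injEq] at hh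
    obtain ⟨rfl, rfl, rfl⟩ := hh
    rfl
  calc ∑ p : TPlaq P j, F p.src = ∑ q ∈ (Finset.univ : Finset (TPlaq P j)).image ι, F q.1 := by
        rw [Finset.sum_image fun p _ p' _ h => hι h]
    _ ≤ ∑ q : TSite P j × Fin P.d × Fin P.d, F q.1 :=
        Finset.sum_le_sum_of_subset_of_nonneg (Finset.subset_univ _) fun q _ _ => hF q.1
    _ = ∑ x : TSite P j, ∑ _q : Fin P.d × Fin P.d, F x := Fintype.sum_prod_type _
    _ = ∑ x : TSite P j, ((P.d : ℝ) * P.d) * F x := by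
        refine Finset.sum_congr rfl fun x _ => ?_
        rw [Finset.sum_const, Finset.card_univ, Fintype.card_prod, Fintype.card_fin, nsmul_eq_mul]
        push_cast
        ring
    _ = (P.d : ℝ) * P.d * ∑ x, F x := by rw [Finset.mul_sum]

/-- **Plaquette row sums on the torus**: `Σ_{p₂} e^{−a·pdist(p₁,p₂)} ≤ d²·(2(1+a⁻¹))^d` for `a > 0`, uniformly in the torus (p20's site sum
`B3TorusRadialSums.sum_exp_neg_tdist_le`). [cite: BalabanImbrieJaffe1988, (2.16) p.261] -/
theorem sum_plaq_exp_neg_pdist_le {a : ℝ} (ha : 0 < a) (p₁ : TPlaq P j) :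
    ∑ p₂ : TPlaq P j, Real.exp (-a * pdist p₁ p₂) ≤ (P.d : ℝ) * P.d * (2 * (1 + a⁻¹)) ^ P.d := by
  have h := sum_plaq_le_sum_site (P := P) (j := j) (F := fun y => Real.exp (-a * (p₁.src.tdist y : ℝ))) fun y => (Real.exp_pos _).le
  refine h.trans (mul_le_mul_of_nonneg_left ?_ (by positivity))
  refine le_trans (le_of_eq (Finset.sum_congr rfl fun y _ => by rw [neg_mul])) (sum_exp_neg_tdist_le ha p₁.src)

/-! ## §2  (2.17) on the torus with its constant -/

/-- **(2.17) on the torus carriers.**  `σ` a kernel on `Plaq P j` with (2.16) at `p₁` beyond `R` (rate `δ`, row sum `≤ S`) and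
`|(σg)(p₁)| ≤ M‖g‖_∞` on curls `g = ∂^{c}B`; `f = ∂^{c}A` on the box of radius `R` about the base point of `p₁` (`2R < sitesPerDir j`, `c ≠ 0`).
Then `|(σf)(p₁)| ≤ (M·8(d−1)R + c₀S(1 + 8(d−1)R))·‖f‖_∞` — `BIJ88Ineq217Mechanism.abs_ineq217` with the near part `∂□A′` of
`BIJ88Ineq217NearPart`. [cite: BalabanImbrieJaffe1988, (2.17) p.262] -/
theorem abs_ineq217_torus {σ : TPlaq P j → TPlaq P j → ℝ} {c₀ δ M S c : ℝ} (hc₀ : 0 ≤ c₀) (hM : 0 ≤ M) (hc : c ≠ 0) {R : ℕ}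
    (hR : 2 * R < P.sitesPerDir j) {p₁ : TPlaq P j} {z₁ : Fin P.d → ℤ} (h₁ : p₁.src = castSite z₁)
    (h216 : ∀ p₂, (R : ℝ) ≤ pdist p₁ p₂ → |σ p₁ p₂| ≤ c₀ * Real.exp (-δ * pdist p₁ p₂))
    (hS : ∑ p₂, Real.exp (-δ * pdist p₁ p₂) ≤ S)
    (hV : ∀ g ∈ Set.range (curl c : VecField P j ℝ → TPlaq P j → ℝ), |applyK σ g p₁| ≤ M * supNorm g)
    {f : TPlaq P j → ℝ} {A : VecField P j ℝ} (hf : ∀ p ∈ boxPlaqs (loOf z₁ R) (hiOf z₁ R), f p = curl c A p) :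
    |applyK σ f p₁| ≤ (M * (8 * ((P.d - 1 : ℕ) : ℝ) * R) + c₀ * S * (1 + 8 * ((P.d - 1 : ℕ) : ℝ) * R)) * supNorm f :=
  abs_ineq217 hc₀ hM h216 hS hV (nearCurl_mem_range c A _ _) (nearCurl_agree_of_pdist_lt h₁ hf)
    (supNorm_nearCurl_le_centred hc hR hf)

/-- **(2.17) on the torus, row sum discharged** (`δ > 0`, `S = d²(2(1+δ⁻¹))^d`). [cite: BalabanImbrieJaffe1988, (2.17) p.262] -/
theorem abs_ineq217_torus' {σ : TPlaq P j → TPlaq P j → ℝ} {c₀ δ M c : ℝ} (hc₀ : 0 ≤ c₀) (hM : 0 ≤ M) (hδ : 0 < δ) (hc : c ≠ 0)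
    {R : ℕ} (hR : 2 * R < P.sitesPerDir j) {p₁ : TPlaq P j} {z₁ : Fin P.d → ℤ} (h₁ : p₁.src = castSite z₁)
    (h216 : ∀ p₂, (R : ℝ) ≤ pdist p₁ p₂ → |σ p₁ p₂| ≤ c₀ * Real.exp (-δ * pdist p₁ p₂))
    (hV : ∀ g ∈ Set.range (curl c : VecField P j ℝ → TPlaq P j → ℝ), |applyK σ g p₁| ≤ M * supNorm g)
    {f : TPlaq P j → ℝ} {A : VecField P j ℝ} (hf : ∀ p ∈ boxPlaqs (loOf z₁ R) (hiOf z₁ R), f p = curl c A p) :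
    |applyK σ f p₁| ≤ (M * (8 * ((P.d - 1 : ℕ) : ℝ) * R) +
      c₀ * ((P.d : ℝ) * P.d * (2 * (1 + δ⁻¹)) ^ P.d) * (1 + 8 * ((P.d - 1 : ℕ) : ℝ) * R)) * supNorm f :=
  abs_ineq217_torus hc₀ hM hc hR h₁ h216 (sum_plaq_exp_neg_pdist_le hδ p₁) hV hf

/-! ## §3  The typed row with the printed side condition -/

/-- **THE TYPED ROW ON THE TORUS**: r18's `Ineq217 σ Near` (print's display `(σ_kf^{(k)})(p₁) ≦ ‖f^{(k)}‖_∞`, constant 1) with `Near p₁ f` :=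
the printed side condition «f^{(k)}(p₂) = (∂A)(p₂) for p₂ near p₁» (`∃ A, f = ∂^{c}A` on the box of radius `R` about the canonical lift of the
base point of `p₁`), given (2.16) beyond `R` with rate `δ > 0` at every `p₁`, the sup-boundedness `M` of `σ` on curls, a non-wrapping radius
(`2R < sitesPerDir j`), and the smallness of the explicit constant. [cite: BalabanImbrieJaffe1988, (2.17) p.262] -/
theorem ineq217_typed_torus {σ : TPlaq P j → TPlaq P j → ℝ} {c₀ δ M c : ℝ} (hc₀ : 0 ≤ c₀) (hM : 0 ≤ M) (hδ : 0 < δ) (hc : c ≠ 0)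
    {R : ℕ} (hR : 2 * R < P.sitesPerDir j)
    (h216 : ∀ p₁ p₂, (R : ℝ) ≤ pdist p₁ p₂ → |σ p₁ p₂| ≤ c₀ * Real.exp (-δ * pdist p₁ p₂))
    (hV : ∀ g ∈ Set.range (curl c : VecField P j ℝ → TPlaq P j → ℝ), ∀ p, |applyK σ g p| ≤ M * supNorm g)
    (hsmall : M * (8 * ((P.d - 1 : ℕ) : ℝ) * R) +
      c₀ * ((P.d : ℝ) * P.d * (2 * (1 + δ⁻¹)) ^ P.d) * (1 + 8 * ((P.d - 1 : ℕ) : ℝ) * R) ≤ 1) :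
    Ineq217 σ (fun p₁ f => ∃ A : VecField P j ℝ,
      ∀ p ∈ boxPlaqs (loOf (fun κ => ((p₁.src κ).val : ℤ)) R) (hiOf (fun κ => ((p₁.src κ).val : ℤ)) R), f p = curl c A p) := by
  intro f p₁ hf
  obtain ⟨A, hA⟩ := hf
  have h := abs_ineq217_torus' hc₀ hM hδ hc hR (castSite_lift p₁.src).symm (h216 p₁) (fun g hg => hV g hg p₁) hA
  exact (le_abs_self _).trans (h.trans ((mul_le_mul_of_nonneg_right hsmall (supNorm_nonneg f)).trans_eq (one_mul _)))

end

end Literature.MathematicalPhysics.QuantumFieldTheory.BalabanImbrieJaffe1984to88.BIJ88Ineq217Torus
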